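import Literature.Barriers.ValiantsHypothesis.CKRST20NaturalProofsExist
import Literature.Combinatorics.ZeroPatterns
import HarnessLib

/-!
# CKRST 2020, §5.2 (v2) = ECCC §5.3: the equations for definable polynomials with small
# coefficients — proofs of ‹Cor 22› and ‹Lemma 23›

Discharges of two named facts of `CKRST20NaturalProofsExist.lean` (P. Chatterjee, M. Kumar,
C. Ramya, R. Saptharishi, A. Tengse, *On the existence of algebraically natural proofs*, FOCS 2020;
arXiv:2004.14147 v2 ‹Cor 22›, ‹Lemma 23› = ECCC TR20-063 Cor. 4.2 (circuits) / Lemma 5.8):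

* `CKRST2020_cor22_holds : CKRST2020_cor22` — the number of `s`-definable `n`-variate polynomials
  of degree `≤ d` with all coefficients in a finite `Δ ⊂ ℤ` is at most `(|Δ| s)^{s^e}` (one
  absolute `e`);
* `CKRST2020_lemma23_holds : CKRST2020_lemma23` — hitting sets `ℋ ⊂ [d·s·|Δ|]^n`, `|ℋ| ≤ s^e`,
  for that class.

## Proofs and the one deviation from print

‹Cor 22› as printed combines ‹Lemma 20› (the universal map `𝒰 : ℂ^r → ℂ^N` for definable
polynomials, `CKRST2020_lemma20_holds`) with ‹Lemma 21› = [HY11a, Claim 3.6] (a point count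
`|F(V) ∩ Δ^m| ≤ r (|Δ| d)^k` on irreducible varieties, the named fact
`CKRST2020_lemma21_affineSpace`, not proved in the tree: no degree theory of affine varieties).
Here the last step is REPLACED by the Rónyai–Babai–Ganapathy zero-pattern count
(`Literature.Combinatorics.RBG.card_patterns_le_pow`, [RBG01, Thm. 1.1], proved in the tree): a
coefficient vector in `Δ^N` realised as `𝒰(y)` is determined by the zero pattern at `y` of the
`N·|Δ|` polynomials `𝒰_μ - z`, so there are at most `(N·|Δ|·deg 𝒰 + 1)^r = (|Δ| s)^{poly(s)}`
of them (`N ≤ (s+1)^n`, `n ≤ s`, `r, deg 𝒰 ≤ s^e`). ‹Lemma 23› then follows the printed proof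
verbatim: the class is finite of size `K ≤ (|Δ| s)^{s^e}`, a nonzero member has degree `≤ d` and
vanishes on at most a `d/L = 1/(s|Δ|)` fraction of the grid `[L]^n`, `L = d s |Δ|` (v2 ‹Lemma 10›
= Mathlib `MvPolynomial.schwartz_zippel_totalDegree`), so some `(s^e + 1)`-tuple of grid points
hits every member (`K · (d L^{n-1})^h < (L^n)^h`). Exponents: `2e₂₀ + 4` for ‹Cor 22›,
`e₂₂ + 1` for ‹Lemma 23›.

## References

* [ChatterjeeKumarRamyaSaptharishiTengse2020] arXiv:2004.14147 v2 ‹Cor 22› (p0014.txt:L44),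
  ‹Lemma 23› (p0014.txt:L59); ECCC TR20-063 Cor. 4.2, Lemma 5.8; arXiv v4 Lemma 3.7.
* [RonyaiBabaiGanapathy2001] L. Rónyai, L. Babai, M. K. Ganapathy, J. AMS 14 (2001), Thm. 1.1
  (`ZeroPatterns.lean`).
* [HrubesYehudayoff2011] P. Hrubeš, A. Yehudayoff, *Arithmetic complexity in ring extensions*,
  Theory Comput. 7 (2011), Claim 3.6 (the printed route, not used).
-/

noncomputable section

namespace Literature.Barriers.ValiantsHypothesis

open Literature.Computability.AlgebraicComplexity MvPolynomial

/-! ### Discharge of `CKRST2020_cor22` (counting definable polynomials with coefficients in `Δ`) -/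

section Cor22Proof

namespace CKRST2020

open Literature.Combinatorics

/-- Substituting polynomials of degree `≤ 1` does not increase the total degree. [folklore] -/
private theorem totalDegree_aeval_le_of_le_one {S σ τ : Type*} [CommSemiring S]
    (h : σ → MvPolynomial τ S) (hh : ∀ i, (h i).totalDegree ≤ 1) (g : MvPolynomial σ S) :
    (aeval h g).totalDegree ≤ g.totalDegree := by
  -- adapted from Literature/RingTheory/MvPolynomial/IteratedDerivations.lean (not imported here)
  conv_lhs => rw [g.as_sum]
  rw [map_sum]
  refine totalDegree_finsetSum_le fun d hd => ?_
  rw [aeval_monomial, ← C_eq_algebraMap]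
  refine (totalDegree_mul _ _).trans ?_
  rw [totalDegree_C, zero_add, Finsupp.prod]
  refine (totalDegree_finsetProd _ _).trans ?_
  calc ∑ i ∈ d.support, (h i ^ d i).totalDegree ≤ ∑ i ∈ d.support, d i := by
        gcongr with i
        calc (h i ^ d i).totalDegree ≤ d i * (h i).totalDegree := totalDegree_pow _ _
          _ ≤ d i * 1 := Nat.mul_le_mul_left _ (hh i)
          _ = d i := mul_one _
    _ ≤ g.totalDegree := le_totalDegree hd

/-- `deg Σ_{α ∈ {0,1}^m} g(x, α) ≤ deg g` (v2 ‹Def 14›: an `s`-definable polynomial has degree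
`≤ s`). [cite: ChatterjeeKumarRamyaSaptharishiTengse2020, Def. 5.1 (ECCC) = v2 ‹Def 14›] -/
private theorem totalDegree_boolSum_le {R : Type*} [CommSemiring R] {σ : Type*} {m : ℕ}
    (g : MvPolynomial (σ ⊕ Fin m) R) : (boolSum g).totalDegree ≤ g.totalDegree := by
  unfold boolSum
  refine totalDegree_finsetSum_le fun e _ => totalDegree_aeval_le_of_le_one _ (fun i => ?_) g
  rcases i with i | j
  · simp only [Sum.elim_inl]
    calc (X i : MvPolynomial _ R).totalDegree
        = (monomial (Finsupp.single i 1) (1 : R)).totalDegree := rfl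
      _ ≤ (Finsupp.single i 1).sum fun _ => id := totalDegree_monomial_le _ _
      _ ≤ 1 := by simp
  · simp only [Sum.elim_inr]
    split_ifs
    · exact totalDegree_one.le.trans zero_le_one
    · exact totalDegree_zero.le.trans zero_le_one

/-- An `s`-definable polynomial has total degree `≤ s`.
[cite: ChatterjeeKumarRamyaSaptharishiTengse2020, Def. 5.1 (ECCC) = v2 ‹Def 14›] -/
private theorem totalDegree_le_of_isDefinable {n s : ℕ} {f : MvPolynomial (Fin n) ℂ}
    (hf : IsDefinable ℂ s f) : f.totalDegree ≤ s := by
  obtain ⟨-, g, hgdeg, -, rfl⟩ := hf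
  exact (totalDegree_boolSum_le g).trans hgdeg

/-- `#x^{≤ s} ≤ (s+1)^n` (every exponent is `≤ s`). [folklore] -/
private theorem card_monomialsDegLE_le (n s : ℕ) [Fintype (monomialsDegLE n s)] :
    Fintype.card (monomialsDegLE n s) ≤ (s + 1) ^ n := by
  classical
  let φ : monomialsDegLE n s → (Fin n → Fin (s + 1)) := fun μ i =>
    ⟨(μ : Fin n →₀ ℕ) i, Nat.lt_succ_of_le ((Finsupp.le_degree i _).trans μ.2)⟩
  have hφ : Function.Injective φ := by
    rintro ⟨μ, hμ⟩ ⟨ν, hν⟩ h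
    refine Subtype.ext (Finsupp.ext fun i => ?_)
    have := congr_fun h i
    simpa [φ] using this
  calc Fintype.card (monomialsDegLE n s) ≤ Fintype.card (Fin n → Fin (s + 1)) :=
        Fintype.card_le_of_injective φ hφ
    _ = (s + 1) ^ n := by simp

/-- The arithmetic of the count: `((s+1)^n · |Δ| · s^e + 1)^r ≤ (|Δ| s)^{s^{2e+4}}` for
`n ≤ s`, `r ≤ s^e`, `s ≥ 2`, `|Δ| ≥ 1`.
[cite: ChatterjeeKumarRamyaSaptharishiTengse2020, v2 ‹Cor 22› (§5.2), proof] -/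
private theorem cor22_arith {n s e r c : ℕ} (hns : n ≤ s) (h2s : 2 ≤ s) (hr : r ≤ s ^ e)
    (hc : 1 ≤ c) :
    ((s + 1) ^ n * c * s ^ e + 1) ^ r ≤ (c * s) ^ (s ^ (2 * e + 4)) := by
  set T := c * s with hT
  have hT2 : 2 ≤ T := by rw [hT]; nlinarith
  have hsT : s ≤ T := by rw [hT]; nlinarith
  have hcT : c ≤ T := by rw [hT]; nlinarith
  -- the base: `(s+1)^n · c · s^e + 1 ≤ T^(2s + e + 2)`
  have h1 : (s + 1) ^ n ≤ T ^ (2 * s) := by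
    calc (s + 1) ^ n ≤ (s + 1) ^ s := Nat.pow_le_pow_right (by omega) hns
      _ ≤ (s * s) ^ s := Nat.pow_le_pow_left (by nlinarith) s
      _ ≤ (T * T) ^ s := Nat.pow_le_pow_left (Nat.mul_le_mul hsT hsT) s
      _ = T ^ (2 * s) := by rw [← pow_two, ← pow_mul, mul_comm]
  have h2 : s ^ e ≤ T ^ e := Nat.pow_le_pow_left hsT e
  have hbase : (s + 1) ^ n * c * s ^ e + 1 ≤ T ^ (2 * s + e + 2) := by
    have hx : (s + 1) ^ n * c * s ^ e ≤ T ^ (2 * s + e + 1) := by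
      calc (s + 1) ^ n * c * s ^ e ≤ T ^ (2 * s) * T * T ^ e :=
            Nat.mul_le_mul (Nat.mul_le_mul h1 hcT) h2
        _ = T ^ (2 * s + e + 1) := by ring
    have hpos : 1 ≤ T ^ (2 * s + e + 1) := Nat.one_le_pow _ _ (by omega)
    calc (s + 1) ^ n * c * s ^ e + 1 ≤ T ^ (2 * s + e + 1) + T ^ (2 * s + e + 1) := by omega
      _ = 2 * T ^ (2 * s + e + 1) := by ring
      _ ≤ T * T ^ (2 * s + e + 1) := Nat.mul_le_mul_right _ hT2
      _ = T ^ (2 * s + e + 2) := by ring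
  -- the exponent: `(2s + e + 2) · r ≤ s^(2e+4)`
  have he3 : e + 3 ≤ s ^ (e + 2) :=
    calc e + 3 ≤ 2 ^ (e + 2) := Nat.lt_two_pow_self
      _ ≤ s ^ (e + 2) := Nat.pow_le_pow_left h2s _
  have hs2 : 2 * s ≤ s ^ 2 := by nlinarith
  have hexp : (2 * s + e + 2) * r ≤ s ^ (2 * e + 4) := by
    have h4 : 2 * s + e + 2 ≤ s ^ (e + 4) := by
      have ha : 2 ≤ s ^ 2 := le_trans (by omega) hs2
      have hb : 2 ≤ s ^ (e + 2) := le_trans (by omega) he3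
      calc 2 * s + e + 2 ≤ s ^ 2 + s ^ (e + 2) := by omega
        _ ≤ s ^ 2 * s ^ (e + 2) := Nat.add_le_mul ha hb
        _ = s ^ (e + 4) := by ring
    calc (2 * s + e + 2) * r ≤ s ^ (e + 4) * s ^ e := Nat.mul_le_mul h4 hr
      _ = s ^ (2 * e + 4) := by ring
  calc ((s + 1) ^ n * c * s ^ e + 1) ^ r ≤ (T ^ (2 * s + e + 2)) ^ r :=
        Nat.pow_le_pow_left hbase r
    _ = T ^ ((2 * s + e + 2) * r) := by rw [← pow_mul]
    _ ≤ T ^ (s ^ (2 * e + 4)) := Nat.pow_le_pow_right (by omega) hexp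

end CKRST2020

open Literature.Combinatorics in
/-- **Discharge of `CKRST2020_cor22`** (v2 ‹Cor 22›; cf. ECCC Cor. 4.2). The printed proof bounds
the number of points of the image of the universal map `𝒰 : ℂ^r → ℂ^N` (‹Lemma 20›) in the
grid `Δ^N` by [HY11a, Claim 3.6] (‹Lemma 21›, a point count on varieties); here that last step is
replaced by the Rónyai–Babai–Ganapathy zero-pattern count already in the tree
(`RBG.card_patterns_le_pow`, [RBG01, Thm. 1.1]): a definable `f` with coefficients in `Δ` is
determined by the zero pattern of the `N·|Δ|` polynomials `𝒰_μ(y) - z` (`μ ∈ x^{≤ s}`,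
`z ∈ Δ`) at its parameter `y_f` (`𝒰_μ(y_f) = coeff_μ f`, `CKRST2020_lemma20_holds`), and there
are at most `(N·|Δ|·s^e + 1)^r ≤ (|Δ| s)^{s^{2e+4}}` such patterns (`N ≤ (s+1)^n`, `n ≤ s`,
`r ≤ s^e`; an `s`-definable polynomial has `n ≤ s` and degree `≤ s`, so `x^{≤ s}` carries all
its coefficients; `n = 0`: the constants `z ∈ Δ`).
[cite: ChatterjeeKumarRamyaSaptharishiTengse2020, v2 ‹Cor 22› (§5.2); cf. Cor. 4.2 (ECCC)] -/
theorem CKRST2020_cor22_holds : CKRST2020_cor22 := by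
  classical
  obtain ⟨e, he⟩ := CKRST2020_lemma20_holds
  refine ⟨2 * e + 4, fun n d s Δ hΔ h2s => ?_⟩
  set A := {f : MvPolynomial (Fin n) ℂ | f ∈ definableSlice ℂ n d s ∧
      ∀ μ, ∃ z ∈ Δ, coeff μ f = (z : ℂ)} with hA
  have hc : 1 ≤ Δ.card := hΔ.card_pos
  have hbig : (Δ.card : ℕ∞) ≤ ((Δ.card * s) ^ (s ^ (2 * e + 4)) : ℕ) := by
    exact_mod_cast calc Δ.card ≤ Δ.card * s := Nat.le_mul_of_pos_right _ (by omega)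
      _ ≤ (Δ.card * s) ^ (s ^ (2 * e + 4)) := Nat.le_self_pow (Nat.pos_iff_ne_zero.1 (Nat.one_le_pow _ _ (by omega))) _
  by_cases hns : n ≤ s
  swap
  · -- `n > s`: no `s`-definable polynomials
    have hempty : A = ∅ := Set.eq_empty_of_forall_notMem fun f hf => hns hf.1.2.1
    rw [hempty, Set.encard_empty]
    exact bot_le
  rcases Nat.eq_zero_or_pos n with hn0 | hn
  · -- `n = 0`: the counted polynomials are constants `z ∈ Δ`
    subst hn0
    have hmaps : Set.MapsTo (fun f : MvPolynomial (Fin 0) ℂ => coeff 0 f) A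
        ((fun z : ℤ => (z : ℂ)) '' (Δ : Set ℤ)) := fun f hf => by
      obtain ⟨z, hz, hfz⟩ := hf.2 0
      exact ⟨z, hz, hfz.symm⟩
    have hinj : Set.InjOn (fun f : MvPolynomial (Fin 0) ℂ => coeff 0 f) A := by
      intro f _ g _ hfg
      refine MvPolynomial.ext _ _ fun μ => ?_
      rw [Subsingleton.elim μ 0]
      exact hfg
    calc A.encard ≤ ((fun z : ℤ => (z : ℂ)) '' (Δ : Set ℤ)).encard :=
          Set.encard_le_encard_of_injOn hmaps hinj
      _ = (Δ : Set ℤ).encard := Set.InjOn.encard_image Int.cast_injective.injOn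
      _ = Δ.card := Set.encard_coe_eq_coe_finsetCard Δ
      _ ≤ _ := hbig
  -- `1 ≤ n ≤ s`: the universal map at degree `s`
  obtain ⟨r, U, hr, hUdeg, hU⟩ := he n s s hn hns h2s
  haveI : Fintype (monomialsDegLE n s) := (Finsupp.finite_of_degree_le s).fintype
  -- every counted polynomial lies in the degree-`s` definable slice
  have hA' : ∀ f ∈ A, f ∈ definableSlice ℂ n s s := fun f hf =>
    ⟨CKRST2020.totalDegree_le_of_isDefinable hf.1.2, hf.1.2⟩
  choose! y hy using fun f (hf : f ∈ A) => hU f (hA' f hf)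
  -- the family `𝒰_μ - z`
  let G : monomialsDegLE n s × Δ → MvPolynomial (Fin r) ℂ := fun i =>
    U i.1 - C ((i.2 : ℤ) : ℂ)
  have hG : ∀ f ∈ A, ∀ (μ : monomialsDegLE n s) (z : Δ),
      (μ, z) ∈ RBG.supportPattern G (y f) ↔ coeff (μ : Fin n →₀ ℕ) f ≠ ((z : ℤ) : ℂ) := by
    intro f hf μ z
    rw [RBG.mem_supportPattern]
    simp only [G, map_sub, eval_C, hy f hf μ]
    rw [sub_ne_zero]
    rfl
  have hmaps : Set.MapsTo (fun f => RBG.supportPattern G (y f)) A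
      (RBG.patterns G : Set (Finset (monomialsDegLE n s × Δ))) := fun f _ =>
    Finset.mem_coe.2 (RBG.supportPattern_mem_patterns G (y f))
  have hinj : Set.InjOn (fun f => RBG.supportPattern G (y f)) A := by
    intro f hf g hg hpat
    refine MvPolynomial.ext _ _ fun μ => ?_
    by_cases hμ : μ.degree ≤ s
    · obtain ⟨z, hz, hfz⟩ := hf.2 μ
      have h1 : (⟨μ, hμ⟩, ⟨z, hz⟩) ∉ RBG.supportPattern G (y f) := by
        rw [hG f hf]; exact not_not.2 hfz
      have h2 : (⟨μ, hμ⟩, ⟨z, hz⟩) ∉ RBG.supportPattern G (y g) := by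
        change RBG.supportPattern G (y f) = RBG.supportPattern G (y g) at hpat
        rwa [← hpat]
      rw [hG g hg, not_not] at h2
      exact hfz.trans h2.symm
    · have hlt : ∀ q ∈ A, q.totalDegree < ∑ i ∈ μ.support, μ i := fun q hq =>
        lt_of_le_of_lt (CKRST2020.totalDegree_le_of_isDefinable hq.1.2)
          (lt_of_not_ge (by rwa [← Finsupp.degree_apply]))
      rw [coeff_eq_zero_of_totalDegree_lt (hlt f hf), coeff_eq_zero_of_totalDegree_lt (hlt g hg)]
  -- the zero-pattern count
  have hD : ∑ i, (G i).totalDegree ≤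
      Fintype.card (monomialsDegLE n s × Δ) * s ^ e := by
    calc ∑ i, (G i).totalDegree ≤ ∑ _i : monomialsDegLE n s × Δ, s ^ e :=
          Finset.sum_le_sum fun i _ => (totalDegree_sub_C_le _ _).trans (hUdeg i.1)
      _ = _ := by rw [Finset.sum_const, Finset.card_univ, smul_eq_mul]
  have hpat := RBG.card_patterns_le_pow G hD
  have hcard : Fintype.card (monomialsDegLE n s × Δ) ≤ (s + 1) ^ n * Δ.card := by
    rw [Fintype.card_prod, Fintype.card_coe]
    exact Nat.mul_le_mul_right _ (CKRST2020.card_monomialsDegLE_le n s)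
  calc A.encard ≤ (RBG.patterns G : Set (Finset (monomialsDegLE n s × Δ))).encard :=
        Set.encard_le_encard_of_injOn hmaps hinj
    _ = (RBG.patterns G).card := Set.encard_coe_eq_coe_finsetCard _
    _ ≤ ((Δ.card * s) ^ (s ^ (2 * e + 4)) : ℕ) := by
        exact_mod_cast hpat.trans <|
          (Nat.pow_le_pow_left (Nat.succ_le_succ (Nat.mul_le_mul_right _ hcard)) _).trans <|
          (Nat.pow_le_pow_right (Nat.succ_pos _) (le_of_eq (Fintype.card_fin r))).trans <|
          ((Nat.pow_le_pow_right (Nat.succ_pos _) (le_refl r)).trans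
            (CKRST2020.cor22_arith hns h2s hr hc))

end Cor22Proof

/-! ### Discharge of `CKRST2020_lemma23` (hitting sets for definable polynomials with coefficients
in `Δ`): the count `CKRST2020_cor22_holds`, the polynomial identity lemma on the grid `[d s |Δ|]^n`,
and a union bound over `s^e + 1` independent points -/

section Lemma23Proof

namespace CKRST2020

open Finset Fintype

/-- Polynomial identity lemma on an integer grid read in `ℂ` (v2 ‹Lemma 10› = v4 Lemma 2.3, Mathlib
`MvPolynomial.schwartz_zippel_totalDegree`): a nonzero `f` of degree `≤ d` vanishes on at most
`d · L^(n-1)` points of `S^n`, `#S = L`, `n ≥ 1`.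
[cite: ChatterjeeKumarRamyaSaptharishiTengse2020, Lemma 2.3 (arXiv v4) = v2 ‹Lemma 10›] -/
private theorem card_zeros_le {n d L : ℕ} (hn : 1 ≤ n) (S : Finset ℂ) (hS : S.card = L)
    (hL : 1 ≤ L) {f : MvPolynomial (Fin n) ℂ} (hf : f ≠ 0) (hfd : f.totalDegree ≤ d) :
    #{y ∈ piFinset fun _ : Fin n => S | eval y f = 0} ≤ d * L ^ (n - 1) := by
  classical
  have hSZ := MvPolynomial.schwartz_zippel_totalDegree hf S
  rw [hS] at hSZ
  have hL0 : (0 : ℚ≥0) < L := by exact_mod_cast hL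
  rw [div_le_div_iff₀ (pow_pos hL0 n) hL0] at hSZ
  have hZ : #{y ∈ piFinset fun _ : Fin n => S | eval y f = 0} * L ≤ f.totalDegree * L ^ n := by
    exact_mod_cast hSZ
  obtain ⟨k, rfl⟩ : ∃ k, n = k + 1 := ⟨n - 1, by omega⟩
  rw [Nat.add_sub_cancel]
  rw [pow_succ, ← mul_assoc] at hZ
  exact (Nat.le_of_mul_le_mul_right hZ (by omega)).trans (Nat.mul_le_mul_right _ hfd)

/-- The union bound: `K · (d L^(n-1))^h < (L^n)^h` when `L = d · q`, `K < q^h`, `d, L ≥ 1`.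
[cite: ChatterjeeKumarRamyaSaptharishiTengse2020, Lemma 5.8 (ECCC) = v2 ‹Lemma 23›, proof] -/
private theorem union_bound_lt {K q d L n h : ℕ} (hn : 1 ≤ n) (hL : L = d * q) (hd : 1 ≤ d)
    (hq : 1 ≤ q) (hK : K < q ^ h) :
    K * (d * L ^ (n - 1)) ^ h < (L ^ n) ^ h := by
  obtain ⟨k, rfl⟩ : ∃ k, n = k + 1 := ⟨n - 1, by omega⟩
  rw [Nat.add_sub_cancel]
  have hpos : 0 < (d * L ^ k) ^ h := by subst hL; positivity
  calc K * (d * L ^ k) ^ h < q ^ h * (d * L ^ k) ^ h := Nat.mul_lt_mul_of_pos_right hK hpos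
    _ = (L ^ (k + 1)) ^ h := by rw [← mul_pow, pow_succ, hL]; ring

end CKRST2020

open Finset Fintype in
/-- **Discharge of `CKRST2020_lemma23`** (v2 ‹Lemma 23› = ECCC Lemma 5.8), following the printed
proof: by ‹Cor 22› (`CKRST2020_cor22_holds`) there are at most `K = (|Δ| s)^{s^e}` polynomials in
`𝒟(n,d,s)` with coefficients in `Δ`; a nonzero one has degree `≤ d` and vanishes on at most a
`d/L = 1/(s|Δ|)` fraction of the grid `[L]^n`, `L = d·s·|Δ|` (‹Lemma 10›, Mathlib's
`MvPolynomial.schwartz_zippel_totalDegree`); hence fewer than all `h`-tuples of grid points,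
`h = s^e + 1`, are bad for some such polynomial (`K · (d L^{n-1})^h < (L^n)^h` as `K < (s|Δ|)^h`),
and the points of a good tuple form a hitting set of size `≤ s^e + 1 ≤ s^{e+1}`.
[cite: ChatterjeeKumarRamyaSaptharishiTengse2020, Lemma 5.8 (ECCC) = v2 ‹Lemma 23›] -/
theorem CKRST2020_lemma23_holds : CKRST2020_lemma23 := by
  classical
  obtain ⟨e, he⟩ := CKRST2020_cor22_holds
  refine ⟨e + 1, fun n d s Δ hΔ hn hns hd h2s => ?_⟩
  -- the finite class `𝒜` of nonzero definable polynomials with coefficients in `Δ`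
  set A := {f : MvPolynomial (Fin n) ℂ | f ∈ definableSlice ℂ n d s ∧
      ∀ μ, ∃ z ∈ Δ, coeff μ f = (z : ℂ)} with hA
  have hAK : A.encard ≤ ((Δ.card * s) ^ (s ^ e) : ℕ) := he n d s Δ hΔ h2s
  have hAfin : A.Finite := Set.finite_of_encard_le_coe hAK
  set 𝒜 := hAfin.toFinset.filter (· ≠ 0) with h𝒜
  have h𝒜card : 𝒜.card ≤ (Δ.card * s) ^ (s ^ e) := by
    have h1 : (hAfin.toFinset.card : ℕ∞) ≤ ((Δ.card * s) ^ (s ^ e) : ℕ) := by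
      rw [← Set.Finite.encard_eq_coe_toFinset_card]; exact hAK
    exact (Finset.card_filter_le _ _).trans (by exact_mod_cast h1)
  have hmem𝒜 : ∀ f, f ∈ definableSlice ℂ n d s → (∀ μ, ∃ z ∈ Δ, coeff μ f = (z : ℂ)) → f ≠ 0 →
      f ∈ 𝒜 := fun f h1 h2 h3 => by
    rw [h𝒜, Finset.mem_filter, Set.Finite.mem_toFinset]
    exact ⟨⟨h1, h2⟩, h3⟩
  -- the grid `[L]^n`, `L = d s |Δ|`, read in `ℂ`
  set L : ℕ := d * s * Δ.card with hL
  have hc : 1 ≤ Δ.card := hΔ.card_pos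
  have hL1 : 1 ≤ L := by rw [hL]; exact Nat.one_le_iff_ne_zero.2 (by positivity)
  set I : Finset ℤ := Finset.Icc (1 : ℤ) (L : ℤ) with hI
  set S : Finset ℂ := I.image (fun z : ℤ => (z : ℂ)) with hS
  have hScard : S.card = L := by
    rw [hS, Finset.card_image_of_injective _ Int.cast_injective, hI, Int.card_Icc]
    omega
  set P : Finset (Fin n → ℂ) := piFinset fun _ : Fin n => S with hP
  -- tuples of `h = s^e + 1` grid points, and the bad ones
  set h : ℕ := s ^ e + 1 with hh
  set T : Finset (Fin h → Fin n → ℂ) := piFinset fun _ : Fin h => P with hT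
  set Z : MvPolynomial (Fin n) ℂ → Finset (Fin n → ℂ) := fun f => {y ∈ P | eval y f = 0} with hZ
  set Bad : Finset (Fin h → Fin n → ℂ) := 𝒜.biUnion fun f => piFinset fun _ : Fin h => Z f
    with hBad
  -- counting
  have hZle : ∀ f ∈ 𝒜, (Z f).card ≤ d * L ^ (n - 1) := fun f hf => by
    have hf' := (Finset.mem_filter.1 hf)
    have hfA : f ∈ A := (Set.Finite.mem_toFinset _).1 hf'.1
    exact CKRST2020.card_zeros_le hn S hScard hL1 hf'.2 hfA.1.1
  have hBadcard : Bad.card < T.card := by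
    calc Bad.card ≤ ∑ f ∈ 𝒜, (piFinset fun _ : Fin h => Z f).card := Finset.card_biUnion_le
      _ ≤ ∑ _f ∈ 𝒜, (d * L ^ (n - 1)) ^ h := Finset.sum_le_sum fun f hf => by
          rw [card_piFinset_const]; exact Nat.pow_le_pow_left (hZle f hf) _
      _ = 𝒜.card * (d * L ^ (n - 1)) ^ h := by rw [Finset.sum_const, smul_eq_mul]
      _ ≤ (Δ.card * s) ^ (s ^ e) * (d * L ^ (n - 1)) ^ h := Nat.mul_le_mul_right _ h𝒜card
      _ < (L ^ n) ^ h := by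
          refine CKRST2020.union_bound_lt (q := s * Δ.card) hn (by rw [hL, mul_assoc]) hd
            (by nlinarith) ?_
          rw [mul_comm s, hh]
          exact Nat.pow_lt_pow_right (by nlinarith) (Nat.lt_succ_self _)
      _ = T.card := by rw [hT, card_piFinset_const, hP, card_piFinset_const, hScard]
  obtain ⟨t, htT, htBad⟩ := Finset.exists_mem_notMem_of_card_lt_card hBadcard
  -- read the good tuple back in `ℤ`
  have hcoord : ∀ (j : Fin h) (i : Fin n), ∃ x : ℤ, (1 ≤ x ∧ x ≤ (L : ℤ)) ∧ (x : ℂ) = t j i := by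
    intro j i
    have hj : t j ∈ P := mem_piFinset.1 htT j
    have hi : t j i ∈ S := by rw [hP] at hj; exact mem_piFinset.1 hj i
    rw [hS, Finset.mem_image] at hi
    obtain ⟨x, hx, hxe⟩ := hi
    exact ⟨x, by rw [hI, Finset.mem_Icc] at hx; exact hx, hxe⟩
  choose x hxb hxe using hcoord
  refine ⟨Finset.univ.image x, ?_, ?_, ?_⟩
  · -- coordinates in `[L]`
    intro x' hx' i
    obtain ⟨j, -, rfl⟩ := Finset.mem_image.1 hx'
    exact_mod_cast hxb j i
  · -- size
    calc (Finset.univ.image x).card ≤ (Finset.univ : Finset (Fin h)).card := Finset.card_image_le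
      _ = s ^ e + 1 := by rw [Finset.card_univ, Fintype.card_fin]
      _ ≤ s ^ e * s := by nlinarith [Nat.one_le_pow e s (by omega)]
      _ = s ^ (e + 1) := by rw [pow_succ]
  · -- hitting
    intro f hf hcoef hf0
    have hf𝒜 := hmem𝒜 f hf hcoef hf0
    have ht : t ∉ piFinset fun _ : Fin h => Z f := fun ht =>
      htBad (by rw [hBad, Finset.mem_biUnion]; exact ⟨f, hf𝒜, ht⟩)
    rw [mem_piFinset, not_forall] at ht
    obtain ⟨j, hj⟩ := ht
    have hjP : t j ∈ P := mem_piFinset.1 htT j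
    have hne : eval (t j) f ≠ 0 := fun h0 => hj (by rw [hZ]; exact Finset.mem_filter.2 ⟨hjP, h0⟩)
    refine ⟨x j, Finset.mem_image.2 ⟨j, Finset.mem_univ _, rfl⟩, ?_⟩
    have hxj : (fun i => ((x j i : ℤ) : ℂ)) = t j := funext fun i => hxe j i
    rwa [hxj]

end Lemma23Proof

end Literature.Barriers.ValiantsHypothesis

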